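import Mathlib
import Literature.Analysis.FluidPDE.NSWave0
import Literature.Analysis.FluidPDE.ClassicalSolution
import HarnessLib

/-!
# Claim skeleton (D-0090 NS-CLAIMS, C26): Han, arXiv:1307.1012 v1 (2013) — global smooth solutions for `H^∞` (max-norm) data

Typed skeleton (T2, QUICK grain; §0.2 self-serve by ns-claims-typist-7, chair silent) of Yongqian Han,
*Existence and Uniqueness of Global Smooth Solution of Incompressible Navier-Stokes Equation*, arXiv:1307.1012
[math.AP] **v1 of 2013-07-03 = version of record** (14 pp; bib `Han2013`); v2 2013-07-31 = WITHDRAWAL, arXiv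
comment verbatim: «This paper has been withdrawn by the author due to a crucial error in Section 2». Locators
«l.N» = TeX lines of `pub/ns-claims/sources/Han2013/arXiv-1307.1012v1-TeX_PINNED/NS20130609.tex` (lit-3
LOCATORS.md) + the printed numbering. UNREFEREED (withdrawn) CLAIM under adjudication — NOTHING in this file
asserts a step of the paper: its statements are `def … : Prop`; the `theorem`s are kernel-checked relations.
Card `pub/ns-claims/claims/Han2013/CARD.md` (PREDICTION §4 frozen 2026-08-26T21:55Z).

## The setting and THE SPACE (l.118–174)

(NS1)–(NSi) l.120–131: `u_t − νΔu + (u·∇)u + ∇P = 0`, `∇·u = 0`, `u|_{t=0} = u₀` on `ℝ³`, `ν > 0`, no force.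
`H(ℝ³)` = divergence-free `(L²)³` fields (l.152–156). **`H^∞(ℝ³)`** (l.163–174, (1.?) `norm0`/`S-HI`):
«the completion of `∩_{m≥0} H^m(ℝ³)` endowed with the norm `‖u‖_{H^∞} = max_{m≥0} Σ_{j=1}^{3} ‖∂_j^m u‖_{L²}`,
i.e. `H^∞ = {u ∈ ∩_m H^m : ‖u‖_{H^∞} < ∞}`» — ALL pure derivatives uniformly bounded in `L²` (NOT `∩_m H^m`).
Typed CONCRETELY: `pdPow u j m = ∂_j^m u` via `iteratedFDeriv`, `eHInfNorm u = ⨆_m Σ_j ‖∂_j^m u‖_{L²} ∈ ℝ≥0∞`,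
`MemHInf`.

## The claimed statement

**Theorem 1.1** [Global Solution] (l.195–204): «Assume that `u₀ ∈ H^∞(ℝ³) ∩ H(ℝ³)` and `(u₀·∇)u₀ ∈ H^∞(ℝ³)`.
Then for any `T > 0` there exists a unique solution `u` of the problem (NS1)–(NSi) such that
`u, u_t ∈ C([0,T]; H^∞ ∩ H)`, `(u·∇)u, ∇P ∈ C([0,T]; H^∞)`.» — `ClaimedTheorem` (existence + the regularity
class as time-wise membership with a uniform bound; continuity-in-time of the norms, `u_t`/`∇P` membership
and uniqueness are not typed — QUICK grain, flagged). Theorems 1.2 (l.234–246: data with compact Fourier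
support, by NS scaling from Thm 1.1), 1.3/1.4 (l.258–282: periodic analogues «line by line») are recorded, not
typed. Clay delta (card §3): Δ4 is substantive and on the page — the data classes of Thm 1.1/1.2 do NOT contain
Clay's class (4), so the printed theorems are (A)-WEAKER in data (still open-strength).

## Architecture (l.205–257; §2–§4) and the typed steps

* §2 «Linear Estimates» (l.394–676) — THE SECTION THE AUTHOR WITHDREW FOR: **Lemma 2.1** [Energy Estimates
  of LNS] (l.435–470; proof l.471–626) for the LINEAR Stokes problem (LNS1)–(LNSi) `u_t − νΔu + ∇P = f`,
  `∇·u = 0`, `u(0) = u₀`: (EnEs-LNS1) `‖u(t)‖_{H^∞} ≤ ‖u₀‖_{H^∞} + ∫₀ᵗ‖f(τ)‖_{H^∞}dτ`; **(EnEs-LNS3)**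
  `‖(u·∇)u(t)‖²_{H^∞} ≤ {‖(u₀·∇)u₀‖²_{H^∞} + C‖u₀‖⁴_{H^∞} t + F(t)} eᵗ` with (EnEs-LNS4)
  `F(t) = C∫₀ᵗ(∫₀ˢ‖f‖)⁴ds + C∫₀ᵗ‖f(τ)‖²(‖u₀‖ + ∫₀^τ‖f‖)²dτ`, «C only depends on ν» — `Step_L21` (typed for
  every classical solution of (LNS) from such data; Lemma 2.2 periodic analogue not typed).
* §3 «Local Solution»: **Theorem 3.1** (l.695–703): local existence with `T = T(‖u₀‖_{H^∞}, ‖(u₀·∇)u₀‖_{H^∞}) > 0`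
  in the class, by contraction using Lemma 2.1 (l.704–803) — `Step_T31`.
* §4 «Global Solution»: **Lemma 4.1** [Energy Estimate] (l.831–845): for the local solution,
  `‖u(t)‖²_{H^∞} + ‖(u·∇)u(t)‖²_{H^∞} ≤ {‖u₀‖²_{H^∞} + ‖(u₀·∇)u₀‖²_{H^∞}} exp{C(1+‖u₀‖⁴_{L²})t}`, «C only
  depends on ν» — `Step_L41`; continuation (l.205–206, l.250–257 «the entire argument … carries over») ⇒
  Thm 1.1 — `Step_continuation` (the standard "local time controlled by the norms + a priori bound ⇒ global"
  glue, not displayed).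

COMPOSITION: `claim_of_steps : Step_L21 → Step_T31 → Step_L41 → Step_continuation → ClaimedTheorem` (pure
logic; Lemma 2.1 is on the printed path — consumed by the printed proofs of Thm 3.1 and Lemma 4.1 — and
carries a `_` binder in the kernel composition).

REV 2 (additive, §E below; ns-claims-typist-6 g2, CARD owner, on refuter-6's typing notes): `Step_L21'`
(Lemma 2.1 for its printed class (UinH-L) l.437–447; `step_L21'_of_step_L21`), `Step_L21G` (the Gronwall
sentence l.575–578 of the proof of Lemma 2.1 at the abstract grain, refuter-6's def text verbatim), and
`claim_of_steps' : Step_L21G → Step_L21' → Step_T31 → Step_L41 → Step_continuation → ClaimedTheorem`;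
ORDERED INDEX (rev 2): Step 1 = `Step_L21G` · Step 2 = `Step_L21'` (rev-1 `Step_L21` = wider rendering) ·
Step 3 = `Step_T31` · Step 4 = `Step_L41` · Step 5 = `Step_continuation`.

WHAT THIS IS NOT: not a claim about NS regularity or blow-up; not a claim about any author beyond the typed
locator.
-/

open scoped ENNReal Topology
open _root_.MeasureTheory _root_.Set

namespace Literature.Claims.NS.Han2013

open Literature.Analysis.FluidPDE

noncomputable section

/-- Physical space `ℝ³`. [folklore] -/
abbrev E3 : Type := EuclideanSpace ℝ (Fin 3)

/-! ## A. The space `H^∞` of l.163–174 (concrete) -/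

/-- The pure iterated partial derivative `∂_j^m u` of a vector field (the `m`-th Fréchet derivative evaluated on
`m` copies of `e_j`). [cite: Han2013, (norm0) l.163–168] -/
def pdPow (u : E3 → E3) (j : Fin 3) (m : ℕ) : E3 → E3 :=
  fun x => iteratedFDeriv ℝ m u x (fun _ => EuclideanSpace.single j (1 : ℝ))

/-- **`‖u‖_{H^∞} = max_{m≥0} Σ_{j=1}^{3} ‖∂_j^m u‖_{L²(ℝ³)}`** (l.163–168, display `norm0`), in `ℝ≥0∞` (the
`max` over all `m` as a supremum; `∞` allowed). [cite: Han2013, (norm0) l.163–168] -/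
def eHInfNorm (u : E3 → E3) : ℝ≥0∞ :=
  ⨆ m : ℕ, ∑ j : Fin 3, eLpNorm (pdPow u j m) 2 (volume : Measure E3)

/-- **`u ∈ H^∞(ℝ³)`** (l.169–174, display `S-HI`: «`H^∞ = {u | u ∈ ∩_{m≥0} H^m(ℝ³), ‖u‖_{H^∞} < ∞}`»):
smooth, every pure derivative in `L²`, and the max-norm finite. (Membership in `∩_m H^m` is rendered by
smoothness + `L²` pure derivatives — QUICK grain.) [cite: Han2013, (S-HI) l.169–174] -/
def MemHInf (u : E3 → E3) : Prop :=
  ContDiff ℝ (⊤ : ℕ∞) u ∧ (∀ (j : Fin 3) (m : ℕ), MemLp (pdPow u j m) 2 (volume : Measure E3)) ∧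
    eHInfNorm u < ∞

/-- The convective term `(u·∇)v (x) = Dv(x)[u(x)]`. [cite: Han2013, (NS1) l.120–122] -/
def convect (u v : E3 → E3) : E3 → E3 := fun x => fderiv ℝ v x (u x)

/-! ## B. The claimed statement -/

/-- **Theorem 1.1** [Global Solution] (l.195–204), existence and regularity class: for every `ν > 0` and every
`u₀ ∈ H^∞ ∩ H` (divergence-free, `L²`) with `(u₀·∇)u₀ ∈ H^∞`, and every `T > 0`, there is a classical solution
`(u,P)` of (NS1)–(NSi) on `ℝ³ × [0,T]` with `u(0) = u₀`, `u(t) ∈ H^∞ ∩ H` and `(u·∇)u(t) ∈ H^∞` for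
`t ∈ [0,T]`, with `‖u(t)‖_{H^∞}` bounded on `[0,T]` («`u ∈ C([0,T]; H^∞ ∩ H)`»; time-continuity of the norms,
the `u_t`, `∇P` memberships and uniqueness are not typed). [claim: Han2013, status: under-review] -/
def ClaimedTheorem : Prop :=
  ∀ ν : ℝ, 0 < ν → ∀ u₀ : E3 → E3, MemHInf u₀ → NSWave0.IsDivFree u₀ → MemHInf (convect u₀ u₀) →
    ∀ T : ℝ, 0 < T →
      ∃ (u : ℝ → E3 → E3) (P : ℝ → E3 → ℝ), IsClassicalNSSolutionOn (Icc 0 T) ν 0 u P ∧ u 0 = u₀ ∧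
        (∀ t ∈ Icc 0 T, MemHInf (u t) ∧ MemHInf (convect (u t) (u t))) ∧
        ∃ M : ℝ≥0∞, M < ∞ ∧ ∀ t ∈ Icc 0 T, eHInfNorm (u t) ≤ M

/-! ## C. The steps -/

/-- **A classical solution of the LINEAR Stokes problem (LNS1)–(LNSi)** (l.398–408): `u_t − νΔu + ∇P = f`,
`∇·u = 0` on `ℝ³ × [0,T]`, `u(0) = u₀`, with `u`, `P` smooth (Mathlib's `Laplacian`, `gradient`, time
derivative `deriv`). [cite: Han2013, (LNS1)–(LNSi) l.398–408] -/
def IsClassicalLNSSolutionOn (T ν : ℝ) (f : ℝ → E3 → E3) (u₀ : E3 → E3) (u : ℝ → E3 → E3)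
    (P : ℝ → E3 → ℝ) : Prop :=
  ContDiff ℝ (⊤ : ℕ∞) (fun q : ℝ × E3 => u q.1 q.2) ∧ ContDiff ℝ (⊤ : ℕ∞) (fun q : ℝ × E3 => P q.1 q.2) ∧
    u 0 = u₀ ∧ (∀ t ∈ Icc 0 T, NSWave0.IsDivFree (u t)) ∧
    ∀ t ∈ Icc 0 T, ∀ x : E3,
      deriv (fun s => u s x) t - ν • Laplacian.laplacian (u t) x + gradient (P t) x = f t x

/-- **Lemma 2.1** [Energy Estimates of LNS] (l.435–470; proof l.471–626 — «Section 2», the author's withdrawal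
locator), the ESTIMATES, for every classical solution of (LNS) from `u₀ ∈ H^∞ ∩ H` with `(u₀·∇)u₀ ∈ H^∞` and
`f ∈ L^∞(0,T; H^∞)`: (EnEs-LNS1) `‖u(t)‖_{H^∞} ≤ ‖u₀‖_{H^∞} + ∫₀ᵗ‖f(τ)‖_{H^∞}dτ` and **(EnEs-LNS3)**
`‖(u·∇)u(t)‖²_{H^∞} ≤ {‖(u₀·∇)u₀‖²_{H^∞} + C‖u₀‖⁴_{H^∞}t + F(t)}eᵗ` with (EnEs-LNS4)
`F(t) = C∫₀ᵗ(∫₀ˢ‖f(τ)‖dτ)⁴ds + C∫₀ᵗ‖f(τ)‖²(‖u₀‖ + ∫₀^τ‖f(s)‖ds)²dτ`, «positive constant `C` only depends on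
`ν`» (`∃ C` after `ν`, before the data). (The lemma's existence/uniqueness clause and (ASG-1) are not typed;
norms in `ℝ≥0∞`.) [claim: Han2013, status: under-review] -/
def Step_L21 : Prop :=
  ∀ ν : ℝ, 0 < ν → ∃ C : ℝ, 0 < C ∧
    ∀ (T : ℝ) (f : ℝ → E3 → E3) (u₀ : E3 → E3) (u : ℝ → E3 → E3) (P : ℝ → E3 → ℝ), 0 < T →
      MemHInf u₀ → NSWave0.IsDivFree u₀ → MemHInf (convect u₀ u₀) →
      (∀ t ∈ Icc 0 T, MemHInf (f t)) → (∃ B : ℝ≥0∞, B < ∞ ∧ ∀ t ∈ Icc 0 T, eHInfNorm (f t) ≤ B) →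
      IsClassicalLNSSolutionOn T ν f u₀ u P →
      ∀ t ∈ Icc 0 T,
        eHInfNorm (u t) ≤ eHInfNorm u₀ + ∫⁻ τ in Ioo 0 t, eHInfNorm (f τ) ∧
        eHInfNorm (convect (u t) (u t)) ^ 2 ≤
          ENNReal.ofReal (Real.exp t) *
            (eHInfNorm (convect u₀ u₀) ^ 2 + ENNReal.ofReal (C * t) * eHInfNorm u₀ ^ 4 +
              (ENNReal.ofReal C * ∫⁻ s in Ioo 0 t, (∫⁻ τ in Ioo 0 s, eHInfNorm (f τ)) ^ 4 +
                ENNReal.ofReal C * ∫⁻ τ in Ioo 0 t,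
                  eHInfNorm (f τ) ^ 2 * (eHInfNorm u₀ + ∫⁻ s in Ioo 0 τ, eHInfNorm (f s)) ^ 2))

/-- **Theorem 3.1** [Local Solution] (l.695–703; proof by contraction l.704–803 using Lemma 2.1): «there exist
`T = T(‖u₀‖_{H^∞}, ‖(u₀·∇)u₀‖_{H^∞}) > 0` and a unique solution … `u, u_t ∈ C([0,T]; H^∞ ∩ H)`,
`(u·∇)u, ∇P ∈ C([0,T]; H^∞)`» — typed: the existence time depends only on the two norms (a function
`Tloc : ℝ≥0∞ → ℝ≥0∞ → ℝ`, positive on finite arguments), with a classical solution in the class on `[0, Tloc]`.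
[claim: Han2013, status: under-review] -/
def Step_T31 : Prop :=
  ∀ ν : ℝ, 0 < ν → ∃ Tloc : ℝ≥0∞ → ℝ≥0∞ → ℝ, (∀ a b : ℝ≥0∞, a < ∞ → b < ∞ → 0 < Tloc a b) ∧
    ∀ u₀ : E3 → E3, MemHInf u₀ → NSWave0.IsDivFree u₀ → MemHInf (convect u₀ u₀) →
      ∃ (u : ℝ → E3 → E3) (P : ℝ → E3 → ℝ),
        IsClassicalNSSolutionOn (Icc 0 (Tloc (eHInfNorm u₀) (eHInfNorm (convect u₀ u₀)))) ν 0 u P ∧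
          u 0 = u₀ ∧
          ∀ t ∈ Icc 0 (Tloc (eHInfNorm u₀) (eHInfNorm (convect u₀ u₀))),
            MemHInf (u t) ∧ NSWave0.IsDivFree (u t) ∧ MemHInf (convect (u t) (u t))

/-- **Lemma 4.1** [Energy Estimate] (l.831–845; proof l.846–985): for a classical solution of (NS1)–(NSi) in
the class on `[0,T]` from such data, `‖u(t)‖²_{H^∞} + ‖(u·∇)u(t)‖²_{H^∞} ≤ {‖u₀‖²_{H^∞} + ‖(u₀·∇)u₀‖²_{H^∞}}
· exp{C(1 + ‖u₀‖⁴_{L²})t}` for `t ∈ [0,T]`, «positive constant `C` only depends on `ν`» — the global a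
priori bound. [claim: Han2013, status: under-review] -/
def Step_L41 : Prop :=
  ∀ ν : ℝ, 0 < ν → ∃ C : ℝ, 0 < C ∧
    ∀ (T : ℝ) (u₀ : E3 → E3) (u : ℝ → E3 → E3) (P : ℝ → E3 → ℝ), 0 < T →
      MemHInf u₀ → NSWave0.IsDivFree u₀ → MemHInf (convect u₀ u₀) →
      IsClassicalNSSolutionOn (Icc 0 T) ν 0 u P → u 0 = u₀ →
      (∀ t ∈ Icc 0 T, MemHInf (u t) ∧ MemHInf (convect (u t) (u t))) →
      ∀ t ∈ Icc 0 T,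
        eHInfNorm (u t) ^ 2 + eHInfNorm (convect (u t) (u t)) ^ 2 ≤
          (eHInfNorm u₀ ^ 2 + eHInfNorm (convect u₀ u₀) ^ 2) *
            ENNReal.ofReal (Real.exp (C * (1 + (eLpNorm u₀ 2 (volume : Measure E3)).toReal ^ 4) * t))

/-- **Continuation** (l.205–206 «Theorem 1.1 ⇐ Lemma 4.1 + Theorem 3.1»; the standard glue, not displayed):
local existence with a time depending only on the two norms, plus the a priori bound of Lemma 4.1 on every
interval of existence, give a solution in the class on every `[0,T]`. Typed as the implication the paper uses.
[claim: Han2013, status: under-review] -/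
def Step_continuation : Prop :=
  Step_T31 → Step_L41 → ClaimedTheorem

/-! ## D. Composition -/

/-- **COMPOSITION**: Lemma 2.1 (on the printed path: consumed by the printed proofs of Thm 3.1 and Lemma 4.1;
`_` binder), Thm 3.1, Lemma 4.1 and the continuation glue imply Theorem 1.1. Pure logic.
[claim: Han2013, status: under-review] -/
theorem claim_of_steps (_h21 : Step_L21) (h31 : Step_T31) (h41 : Step_L41) (hc : Step_continuation) :
    ClaimedTheorem :=
  hc h31 h41

/-! ## E. Revision 2 (ADDITIVE, ns-claims-typist-6 g2 as CARD owner, 2026-08-27; refuter-6 typing notes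
2026-08-26T23:47:58Z / 23:58:49Z). Nothing above is changed. Two decls are added at the grain the refuter
and referee asked for: `Step_L21'` = Lemma 2.1's estimates restricted to the CLASS the lemma prints for its
solution («`u ∈ C([0,T];H^∞(ℝ³) ∩ H(ℝ³))`», l.437–447 (UinH-L)) — the rev-1 `Step_L21` quantifies over every
classical solution of (LNS), a wider class than printed; and `Step_L21G` = the GRONWALL SENTENCE of the proof
of Lemma 2.1 (l.575–578) at the abstract grain at which it is used: from (LEs-mF2) summed over `j` and
maximised over `m ≥ 0`, i.e. from `X(t) ≤ A(t) + ∫₀ᵗ X(τ)dτ` with `X(t) = ‖(u·∇)u(t)‖²_{H^∞} ∈ [0,∞]` (whose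
finiteness is part of what the lemma asserts, (UinH-L)) and `A` finite nondecreasing, conclude
`X(t) ≤ A(t)eᵗ` = (EnEs-LNS3). (LEs-mF2) itself is not typed (constants of the «sum over `j`, max over `m`»
passage are not printed). The ordered index becomes: Step 1 = `Step_L21G` (l.575–578, inside the proof of
Lemma 2.1) · Step 2 = `Step_L21'` (Lemma 2.1 as printed for its class; `Step_L21` = rev-1 wider rendering,
`step_L21'_of_step_L21`) · Step 3 = `Step_T31` · Step 4 = `Step_L41` · Step 5 = `Step_continuation`;
`claim_of_steps'` composes in that order (Steps 1–2 are on the printed path and carry `_` binders, as in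
rev 1). -/

/-- **Lemma 2.1 restricted to its printed class** (l.435–470 with (UinH-L) l.437–447: «there exists a unique
global solution `u` … such that `u ∈ C([0,T];H^∞(ℝ³) ∩ H(ℝ³))` … and the following estimates are valid»):
the rev-1 `Step_L21` with the additional class hypothesis `u(t) ∈ H^∞` for `t ∈ [0,T]` (true for the
semigroup solution by (EnEs-LNS1); the finiteness of `‖(u·∇)u(t)‖_{H^∞}` is NOT assumed — it is part of the
conclusion (UinH-L)/(EnEs-LNS3)). Weaker than `Step_L21` (`step_L21'_of_step_L21`).
[cite: Han2013, Lemma 2.1 (EnEs-LNS1)/(EnEs-LNS3)/(EnEs-LNS4) l.435–470, class (UinH-L) l.437–447]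
[claim: Han2013, status: under-review] -/
def Step_L21' : Prop :=
  ∀ ν : ℝ, 0 < ν → ∃ C : ℝ, 0 < C ∧
    ∀ (T : ℝ) (f : ℝ → E3 → E3) (u₀ : E3 → E3) (u : ℝ → E3 → E3) (P : ℝ → E3 → ℝ), 0 < T →
      MemHInf u₀ → NSWave0.IsDivFree u₀ → MemHInf (convect u₀ u₀) →
      (∀ t ∈ Icc 0 T, MemHInf (f t)) → (∃ B : ℝ≥0∞, B < ∞ ∧ ∀ t ∈ Icc 0 T, eHInfNorm (f t) ≤ B) →
      IsClassicalLNSSolutionOn T ν f u₀ u P →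
      (∀ t ∈ Icc 0 T, MemHInf (u t)) →
      ∀ t ∈ Icc 0 T,
        eHInfNorm (u t) ≤ eHInfNorm u₀ + ∫⁻ τ in Ioo 0 t, eHInfNorm (f τ) ∧
        eHInfNorm (convect (u t) (u t)) ^ 2 ≤
          ENNReal.ofReal (Real.exp t) *
            (eHInfNorm (convect u₀ u₀) ^ 2 + ENNReal.ofReal (C * t) * eHInfNorm u₀ ^ 4 +
              (ENNReal.ofReal C * ∫⁻ s in Ioo 0 t, (∫⁻ τ in Ioo 0 s, eHInfNorm (f τ)) ^ 4 +
                ENNReal.ofReal C * ∫⁻ τ in Ioo 0 t,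
                  eHInfNorm (f τ) ^ 2 * (eHInfNorm u₀ + ∫⁻ s in Ioo 0 τ, eHInfNorm (f s)) ^ 2))

/-- `Step_L21'` is the rev-1 `Step_L21` with one more hypothesis, hence implied by it (pure logic).
[cite: Han2013, Lemma 2.1 l.435–470] -/
theorem step_L21'_of_step_L21 (h : Step_L21) : Step_L21' := by
  intro ν hν
  obtain ⟨C, hC, hall⟩ := h ν hν
  exact ⟨C, hC, fun T f u₀ u P hT hu₀ hdiv hconv hf hB hsol _ t ht =>
    hall T f u₀ u P hT hu₀ hdiv hconv hf hB hsol t ht⟩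

/-- **The Gronwall sentence of the proof of Lemma 2.1** (l.575–578): «On the left-hand side of (LEs-mF2), let
us set `D^m = ∂_j^m`, sum with respect to `j` from 1 to 3 and take the maximum with respect to `m ≥ 0`. Then
by using Gronwall inequality, we derive the estimate (EnEs-LNS3)» — typed at the ABSTRACT GRAIN at which it
is used (text = ns-claims-refuter-6's scratch def VERBATIM, `claims/Han2013/refuter6-StepL21G-scratch.lean`
sha16 38459070b8a76141): for `X, A : ℝ → [0,∞]` on `[0,T]` with `A` nondecreasing and finite and
`X(t) ≤ A(t) + ∫₀ᵗ X(τ)dτ`, conclude `X(t) ≤ A(t)·eᵗ`. Here `X(t) = ‖(u·∇)u(t)‖²_{H^∞}` — no finiteness,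
measurability or integrability of `X` is available at this point of the printed proof (its finiteness is
asserted by the lemma itself, (UinH-L)), so none is assumed; `A(t) = ‖(u₀·∇)u₀‖²_{H^∞} + C‖u₀‖⁴_{H^∞}t + F(t)`.
[cite: Han2013, proof of Lemma 2.1, TeX l.575–578 «Then by using Gronwall inequality, we derive (EnEs-LNS3)»;
input (LEs-mF2) l.560–574] [claim: Han2013, status: under-review] -/
def Step_L21G : Prop := ∀ (T : ℝ) (X A : ℝ → ℝ≥0∞), 0 < T → Monotone A → (∀ t ∈ Icc 0 T, A t < ⊤) →
    (∀ t ∈ Icc 0 T, X t ≤ A t + ∫⁻ τ in Ioo 0 t, X τ) → ∀ t ∈ Icc 0 T, X t ≤ A t * ENNReal.ofReal (Real.exp t)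

/-- **COMPOSITION, rev 2** in the refined order: the Gronwall sentence (Step 1) and Lemma 2.1 for its class
(Step 2) are on the printed path (consumed by the printed proofs of Lemma 2.1, Thm 3.1, Lemma 4.1) and carry
`_` binders; Thm 3.1, Lemma 4.1 and the continuation glue imply Theorem 1.1. Pure logic.
[claim: Han2013, status: under-review] -/
theorem claim_of_steps' (_hG : Step_L21G) (_h21 : Step_L21') (h31 : Step_T31) (h41 : Step_L41)
    (hc : Step_continuation) : ClaimedTheorem :=
  hc h31 h41

end

end Literature.Claims.NS.Han2013
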